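import Summits.BirchSwinnertonDyer.BirchSwinnertonDyer.Theorems.GoldfeldK12AdditiveTwoHalfTraceOfShimuraReciprocityDatum
import Summits.BirchSwinnertonDyer.BirchSwinnertonDyer.Theorems.GoldfeldK12AdditiveTwoGenusSquaresOdd
import Summits.BirchSwinnertonDyer.BirchSwinnertonDyer.Theorems.GoldfeldK12AdditiveTwoCuspZeroTwoTorsion
import Literature.NumberTheory.EllipticCurves.HeegnerPointsShimuraReciprocityHoldsProofs
import Literature.NumberTheory.NumberFields.GaussianSqrtFieldInertialValuationProofs
import HarnessLib

set_option linter.dupNamespace false -- namespace `…BirchSwinnertonDyer.BirchSwinnertonDyer…` is the cell's (D-0017 nested layout)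
set_option autoImplicit false

/-!
# The genus half-trace datum and K12₂″ on `49a1^{(−q)}`, `q ≡ 5 (mod 8)`, with the LANDED inputs plugged by name
# (planner g34 ruling (cliv), «FILE5-PLUGS», fallback FILE 6): binders exactly {`hM`, `h12`, (c) `hram`}

Cell `bsd-goldfeld`, seat `bsd-goldfeld-s1p-c201` (prover, gen 13); `--supports stmt-BirchSwinnertonDyer-20044`. Re-export of the
cone theorem `nonempty_genusHalfTraceDatum_of_shimuraReciprocity` and of the consumers of
`…HalfTraceOfShimuraReciprocityDatum` with three of their six named inputs DISCHARGED BY NAME from the tree: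
* `hSR := heegnerPoints_shimuraReciprocity_holds 49 cm7 K` (Darmon 2004 Thm. 3.7, PROVED in the tree by the typer, ty g13 p536438);
* (b₂) `hodd := odd_natCard_range_powMonoidHom_two_classGroup_QO_neg_four_mul Δ q hq hq8 hΔ` (`#Cl(𝒪_{−4q})²` odd for `q ≡ 5 (mod 8)`,
  Gauss–Rédei on the `QO` carrier, seat c3 g16 p533389);
* (d) `hcusp := x049_cuspZeroPoint_eq_twoTorsion_of_abs_eq_one_of_thm12 h12 D₀ hc` (`φ(0) = (2, −1)` for Manin-`±1` parametrisations of
  `X₀(49)`, from CLTZ Thm. 1.2, seat c3 g16 p534836).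
Remaining named inputs: `hM : OptimalCurveManinCertificate cm7` (aside 20085), `h12 : CoatesLiTianZhai2015.thm12_fullBSD_twist`, and the
residual (c) `hram` (ramification of `ℚ(i, √q)/ℚ(i)` at `q`; typer order (4d), to be plugged by whoever lands second), plus Modularity /
Gross–Zagier / Heegner rationality for the `L`-function consumers. HONEST FRAMING: `49a1^{(−q)}`, `q ≡ 5 (mod 8)` prime, `(q/7) = −1`, is a
density-zero family; nothing here closes item 20044 or proves BSD.

References: [Darmon2004] Thm. 3.7; [GrossLMS1991] Prop. 5.3; [CoatesLiTianZhai2015] Thm. 1.2, 1.4, 2.2; [Cox2013] §3.B Thm. 3.15, §6.A;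
[AgasheRibetStein2006] Thm. 2.6; [RedeiReichardt1934].
-/

noncomputable section

open scoped Classical NNReal

open Literature.NumberTheory.EllipticCurves.ModularForms NumberField
open Literature.Computability.Cryptography.Hallgren2005
open Literature.Computability.Cryptography.Hallgren2005.OrderCl

namespace Summit.BirchSwinnertonDyer.BirchSwinnertonDyer.Theorems.GoldfeldGoodTwists

open WeierstrassCurve Literature.NumberTheory.EllipticCurves

variable {q : ℕ}

/-- **THE GENUS-FIELD HALF-TRACE DATUM from print**, binders {`hM`, `h12`, (c) `hram`}: Shimura reciprocity (Darmon Thm. 3.7, tree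
theorem), `#Cl(−4q)²` odd (tree theorem) and `φ(0) = (2,−1)` (tree theorem modulo CLTZ Thm. 1.2) plugged into
`nonempty_genusHalfTraceDatum_of_shimuraReciprocity`. [cite: Darmon2004, Thm. 3.7] [cite: GrossLMS1991, Prop. 5.3]
[cite: CoatesLiTianZhai2015, Thm. 1.2] [cite: AgasheRibetStein2006, Thm. 2.6] -/
theorem nonempty_genusHalfTraceDatum_of_print {K : Type} [Field K] [NumberField K] (hM : OptimalCurveManinCertificate cm7)
    (h12 : CoatesLiTianZhai2015.thm12_fullBSD_twist)
    (hram : ∀ (J : Type) [Field J] [CharZero J], Module.finrank ℚ J = 4 →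
      ∀ (σ : J ≃ₐ[ℚ] J) (i r : J), i ^ 2 = -1 → r ^ 2 = (q : J) → σ i = i → σ r = -r →
      ∃ w : Valuation J ℝ≥0, (∀ x, w (σ x) = w x) ∧ (∀ x, w x ≤ 1 → w (σ x - x) < 1) ∧ w 2 = 1 ∧ w 7 = 1)
    (hq : q.Prime) (hq8 : q % 8 = 5) (hq7 : jacobiSym q 7 = -1) (hK : IsImaginaryQuadratic K)
    (hdK : NumberField.discr K = -(4 * (q : ℤ))) (Dt : ModularParametrizationData cm7 49)
    (H : HeegnerDatum 49 (NumberField.discr K)) (ι : K →+* ℂ) {P : (cm7.baseChange K).toAffine.Point}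
    (hP : Affine.Point.map ι.toRatAlgHom P = heegnerPointComplex Dt H) :
    Nonempty (X049GenusHalfTraceDatum K Dt.c P) :=
  nonempty_genusHalfTraceDatum_of_shimuraReciprocity (heegnerPoints_shimuraReciprocity_holds 49 cm7 K) hM h12
    (fun Δ hΔ ↦ odd_natCard_range_powMonoidHom_two_classGroup_QO_neg_four_mul Δ q hq hq8 hΔ) hram
    (fun D₀ hc ↦ by obtain ⟨h, e⟩ := x049_cuspZeroPoint_eq_twoTorsion_of_abs_eq_one_of_thm12 h12 D₀ hc; exact e)
    hq hq8 hq7 hK hdK Dt H ι hP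

/-- **Clause (i) of LINE B49 for `q ≡ 5 (mod 8)` from print + (c)**: every level-`49` Heegner point of `X₀(49)` over `ℚ(√−q)` has
infinite order. [cite: GrossLMS1991, Prop. 5.3] [cite: Darmon2004, Thm. 3.7] [cite: CoatesLiTianZhai2015, Thm. 1.2 and Thm. 2.2] -/
theorem not_isOfFinAddOrder_heegnerPoint_fiveModEight_of_print {K : Type} [Field K] [NumberField K]
    (hM : OptimalCurveManinCertificate cm7) (h12 : CoatesLiTianZhai2015.thm12_fullBSD_twist)
    (hram : ∀ (J : Type) [Field J] [CharZero J], Module.finrank ℚ J = 4 →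
      ∀ (σ : J ≃ₐ[ℚ] J) (i r : J), i ^ 2 = -1 → r ^ 2 = (q : J) → σ i = i → σ r = -r →
      ∃ w : Valuation J ℝ≥0, (∀ x, w (σ x) = w x) ∧ (∀ x, w x ≤ 1 → w (σ x - x) < 1) ∧ w 2 = 1 ∧ w 7 = 1)
    (hq : q.Prime) (hq8 : q % 8 = 5) (hq7 : jacobiSym q 7 = -1) (hK : IsImaginaryQuadratic K)
    (hdK : NumberField.discr K = -(4 * (q : ℤ))) {P : (cm7.baseChange K).toAffine.Point} (hP : IsHeegnerPoint 49 cm7 K P) :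
    ¬ IsOfFinAddOrder P := by
  obtain ⟨Dt, H, ι, hPH⟩ := hP
  obtain ⟨D⟩ := nonempty_genusHalfTraceDatum_of_print hM h12 hram hq hq8 hq7 hK hdK Dt H ι hPH
  exact not_isOfFinAddOrder_of_genusHalfTraceDatum Dt.maninConstant_ne_zero_holds D

/-- **K12₂″ ON THE FAMILY `49a1^{(−q)}`, `q ≡ 5 (mod 8)`, from print + (c)**: for every globally minimal model `W` of `49a1^{(−q)}`,
`(q/7) = −1`, the implication of the route decl `RankOneTwoConverseCMSevenAdditiveTwo` (its conclusion `ord_{s=1} L(W, s) = 1` outright),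
granted Modularity, CLTZ Thm. 1.2, Gross–Zagier, Heegner rationality, the Manin certificate of `49a1` and the residual ramification input
(c) as a `∀ q`-schema. Density-zero family; nothing here closes item 20044. [cite: CoatesLiTianZhai2015, Thm. 1.2 and Thm. 1.4]
[cite: GrossZagier1986, Thm. I.(6.3)] [cite: Darmon2004, Thm. 3.7] [cite: BurungaleCastellaSkinnerTian2022, Rem. D (p. 327)] -/
theorem rankOneTwoConverse_inertPrimeTwist_fiveModEight_of_print (hnf : ModularForms.exists_isNewformOf)
    (h12 : CoatesLiTianZhai2015.thm12_fullBSD_twist)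
    (hGZ : ∀ (N : ℕ) [NeZero N] (W : WeierstrassCurve ℚ) (K : Type) [Field K] [NumberField K], gross_zagier N W K)
    (hHP : ∀ (W : WeierstrassCurve ℚ) (K : Type) [Field K] [NumberField K], exists_isHeegnerPoint W K)
    (hM : OptimalCurveManinCertificate cm7)
    (hram : ∀ (q : ℕ), q.Prime → q % 4 = 1 → ∀ (J : Type) [Field J] [CharZero J], Module.finrank ℚ J = 4 →
      ∀ (σ : J ≃ₐ[ℚ] J) (i r : J), i ^ 2 = -1 → r ^ 2 = (q : J) → σ i = i → σ r = -r →
      ∃ w : Valuation J ℝ≥0, (∀ x, w (σ x) = w x) ∧ (∀ x, w x ≤ 1 → w (σ x - x) < 1) ∧ w 2 = 1 ∧ w 7 = 1)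
    (hq : q.Prime) (hq8 : q % 8 = 5) (hq7 : jacobiSym q 7 = -1) (W : WeierstrassCurve ℚ) [W.IsElliptic] [W.IsGloballyMinimal]
    (C : VariableChange ℚ) (hC : C • W = cm7.quadraticTwist ((-q : ℤ) : ℚ)) :
    W.j = -3375 → ¬ W.HasGoodReductionAtPrime 2 → W.selmerCorank 2 = 1 → W.analyticRank = 1 :=
  rankOneTwoConverse_inertPrimeTwist_fiveModEight_of_shimuraReciprocity hnf h12 hGZ hHP
    (fun K _ _ ↦ heegnerPoints_shimuraReciprocity_holds 49 cm7 K) hM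
    (fun q Δ hq hq8 hΔ ↦ odd_natCard_range_powMonoidHom_two_classGroup_QO_neg_four_mul Δ q hq hq8 hΔ) hram
    (fun D₀ hc ↦ by obtain ⟨h, e⟩ := x049_cuspZeroPoint_eq_twoTorsion_of_abs_eq_one_of_thm12 h12 D₀ hc; exact e)
    hq hq8 hq7 W C hC

/-! ## The last residual input (c) plugged: `exists_inertial_valuation_gaussSqrt` (typer ty g14, p540855) — binders exactly {`hM`, `h12`} -/

/-- **The residual input (c) is a tree theorem**: the ramification schema for `ℚ(i, √q)/ℚ(i)` at a prime `q ≡ 5 (mod 8)` is the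
typer's `exists_inertial_valuation_gaussSqrt` (inertia of the ramified quadratic extension `J/ℚ(i)` above `q`).
[cite: Marcus2018, Ch. 4 Thm. 28 and Cor. 1] [cite: NeukirchANT1999, Ch. I (9.6)] -/
theorem inertial_valuation_schema_fiveModEight (hq : q.Prime) (hq8 : q % 8 = 5) :
    ∀ (J : Type) [Field J] [CharZero J], Module.finrank ℚ J = 4 →
      ∀ (σ : J ≃ₐ[ℚ] J) (i r : J), i ^ 2 = -1 → r ^ 2 = (q : J) → σ i = i → σ r = -r →
      ∃ w : Valuation J ℝ≥0, (∀ x, w (σ x) = w x) ∧ (∀ x, w x ≤ 1 → w (σ x - x) < 1) ∧ w 2 = 1 ∧ w 7 = 1 :=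
  fun _ _ _ hJ σ _ _ hi hr hσi hσr ↦
    Literature.NumberTheory.NumberFields.exists_inertial_valuation_gaussSqrt hq (by omega) hJ hi hr σ hσi hσr

/-- **THE GENUS-FIELD HALF-TRACE DATUM, binders {`hM`, `h12`} only** (Manin certificate of `49a1`, aside 20085; CLTZ Thm. 1.2 for the
root number and `φ(0) = (2,−1)`): for every prime `q ≡ 5 (mod 8)` with `(q/7) = −1`, every `K` with `d_K = −4q`, every datum `Dt`,
Heegner datum `H`, embedding `ι` and `P ↦ Σ φ_{Dt}(τ_Q)`, a genus-field half-trace datum EXISTS — conjuncts (a) Shimura reciprocity /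
Gross Prop. 5.3, (b) Gauss–Rédei genus theory for `−4q`, (c) ramification of `ℚ(i,√q)/ℚ(i)` at `q`, (d) the cusp value, ALL by name
from tree theorems. [cite: Darmon2004, Thm. 3.7] [cite: GrossLMS1991, Prop. 5.3] [cite: CoatesLiTianZhai2015, Thm. 1.2]
[cite: AgasheRibetStein2006, Thm. 2.6] -/
theorem nonempty_genusHalfTraceDatum_of_thm12 {K : Type} [Field K] [NumberField K] (hM : OptimalCurveManinCertificate cm7)
    (h12 : CoatesLiTianZhai2015.thm12_fullBSD_twist) (hq : q.Prime) (hq8 : q % 8 = 5) (hq7 : jacobiSym q 7 = -1)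
    (hK : IsImaginaryQuadratic K) (hdK : NumberField.discr K = -(4 * (q : ℤ))) (Dt : ModularParametrizationData cm7 49)
    (H : HeegnerDatum 49 (NumberField.discr K)) (ι : K →+* ℂ) {P : (cm7.baseChange K).toAffine.Point}
    (hP : Affine.Point.map ι.toRatAlgHom P = heegnerPointComplex Dt H) :
    Nonempty (X049GenusHalfTraceDatum K Dt.c P) :=
  nonempty_genusHalfTraceDatum_of_print hM h12 (inertial_valuation_schema_fiveModEight hq hq8) hq hq8 hq7 hK hdK Dt H ι hP

/-- **Clause (i) of LINE B49 for `q ≡ 5 (mod 8)`, binders {`hM`, `h12`}**: every level-`49` Heegner point of `X₀(49)` over `ℚ(√−q)`,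
`q ≡ 5 (mod 8)` prime, `(q/7) = −1`, has infinite order. [cite: GrossLMS1991, Prop. 5.3] [cite: Darmon2004, Thm. 3.7]
[cite: CoatesLiTianZhai2015, Thm. 1.2 and Thm. 2.2] -/
theorem not_isOfFinAddOrder_heegnerPoint_fiveModEight_of_thm12 {K : Type} [Field K] [NumberField K]
    (hM : OptimalCurveManinCertificate cm7) (h12 : CoatesLiTianZhai2015.thm12_fullBSD_twist) (hq : q.Prime)
    (hq8 : q % 8 = 5) (hq7 : jacobiSym q 7 = -1) (hK : IsImaginaryQuadratic K) (hdK : NumberField.discr K = -(4 * (q : ℤ)))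
    {P : (cm7.baseChange K).toAffine.Point} (hP : IsHeegnerPoint 49 cm7 K P) : ¬ IsOfFinAddOrder P :=
  not_isOfFinAddOrder_heegnerPoint_fiveModEight_of_print hM h12 (inertial_valuation_schema_fiveModEight hq hq8) hq hq8 hq7 hK
    hdK hP

/-- **«CONJECTURE D(q)» / K12₂″ ON THE FAMILY `49a1^{(−q)}`, `q ≡ 5 (mod 8)`, `(q/7) = −1`, modulo PRINT ONLY** (Modularity `hnf`,
CLTZ Thm. 1.2 `h12`, Gross–Zagier `hGZ`, Heegner rationality `hHP`, the Manin certificate of `49a1` `hM`): for every globally minimal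
model `W` of `49a1^{(−q)}` the implication of the route decl `RankOneTwoConverseCMSevenAdditiveTwo` holds — indeed its conclusion
`ord_{s=1} L(W, s) = 1` outright. Density-zero prime family: this does NOT close item 20044 and proves nothing about BSD beyond it.
[cite: CoatesLiTianZhai2015, Thm. 1.2 and Thm. 1.4] [cite: GrossZagier1986, Thm. I.(6.3)] [cite: Darmon2004, Thm. 3.7]
[cite: BurungaleCastellaSkinnerTian2022, Rem. D (p. 327)] -/
theorem rankOneTwoConverse_inertPrimeTwist_fiveModEight_of_thm12 (hnf : ModularForms.exists_isNewformOf)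
    (h12 : CoatesLiTianZhai2015.thm12_fullBSD_twist)
    (hGZ : ∀ (N : ℕ) [NeZero N] (W : WeierstrassCurve ℚ) (K : Type) [Field K] [NumberField K], gross_zagier N W K)
    (hHP : ∀ (W : WeierstrassCurve ℚ) (K : Type) [Field K] [NumberField K], exists_isHeegnerPoint W K)
    (hM : OptimalCurveManinCertificate cm7) (hq : q.Prime) (hq8 : q % 8 = 5) (hq7 : jacobiSym q 7 = -1)
    (W : WeierstrassCurve ℚ) [W.IsElliptic] [W.IsGloballyMinimal] (C : VariableChange ℚ)
    (hC : C • W = cm7.quadraticTwist ((-q : ℤ) : ℚ)) :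
    W.j = -3375 → ¬ W.HasGoodReductionAtPrime 2 → W.selmerCorank 2 = 1 → W.analyticRank = 1 :=
  fun _ _ _ ↦ analyticRank_eq_one_inertPrimeTwist_fiveModEight_of_shimuraReciprocity hnf h12 hGZ hHP
    (fun K _ _ ↦ heegnerPoints_shimuraReciprocity_holds 49 cm7 K) hM
    (fun q Δ hq hq8 hΔ ↦ odd_natCard_range_powMonoidHom_two_classGroup_QO_neg_four_mul Δ q hq hq8 hΔ)
    (fun q hq hq4 J _ _ hJ σ _ _ hi hr hσi hσr ↦
      Literature.NumberTheory.NumberFields.exists_inertial_valuation_gaussSqrt hq hq4 hJ hi hr σ hσi hσr)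
    (fun D₀ hc ↦ by obtain ⟨h, e⟩ := x049_cuspZeroPoint_eq_twoTorsion_of_abs_eq_one_of_thm12 h12 D₀ hc; exact e)
    hq hq8 hq7 W C hC

end Summit.BirchSwinnertonDyer.BirchSwinnertonDyer.Theorems.GoldfeldGoodTwists

end
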